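import Mathlib
import HarnessLib
import Literature.MathematicalPhysics.QuantumLattice.HubbardTwoPointSimplexMatch

/-!
# Child `KLRegimeVolumeLimitV12` (stmt-HubbardSuperconductivity-19858), `stub_vl_bound` via (H1): the ORDER-ZERO / ENTRY-LEVEL ANCHOR of the
# τ-resolved two-point identification — the limiting Grassmann entry at the NEGATIVE time difference `−s` is the `a ≤ b` (creation-before-
# annihilation) propagator-matrix entry with creation time `−(β−s)·` … in t2's Dyson variables: creation at `s_a = s − β`… read at `(s, 0)`:
# `vertexLimitEntry L β μ x̄ ȳ σ σ′ (0 − s) = [(1 + e^{βh})⁻¹ e^{s h}]_{(ȳσ′),(x̄σ)}` (seat hubbard-kl-k3c5-p1 g4; HOME/hubbard-kl-k3c5-p1/H1-DESIGN.md §2)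

The right-hand side is the closed Fermi-matrix form of the FREE two-time correlation `⟨a⁺_{x̄σ}(s) c_{ȳσ′}⟩_{β,dΓ(h)}`
(`thermalCorr_dGamma_evolve_creation_annihilation`), i.e. `Tr(e^{−(β−s)H₀}c†_{x̄σ}e^{−sH₀}c_{ȳσ′})/Z₀`, `H₀ = dΓ(h)`, `h = hubbardOneBody (torus) 1 μ`:
the n = 0 term of (H1), stated at the level of MATRIX ENTRIES (as t2's `twoPointLimit_entry_*`), where no instance bookkeeping intervenes.
-/

noncomputable section

namespace Summit.HubbardSuperconductivity.HubbardSuperconductivity.Theorems.TwoPointAssembly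

set_option linter.dupNamespace false -- summit = problem name (single-conjunct summit), D-0017

open Finset NormedSpace Literature.MathematicalPhysics.QuantumLattice Literature.Probability.LatticeModels

variable {L : ℕ} [NeZero L]

/-- **ENTRY-LEVEL ANCHOR of (H1).**  On the `L×L` torus (`L ≥ 3`), for every real `β, μ`, spins `σ σ′`, sites `x̄ ȳ` and every `s > 0`:
`vertexLimitEntry L β μ x̄ ȳ σ σ′ (0 − s) = [e^{−0·h}(1 + e^{βh})⁻¹ e^{s h}]_{(ȳσ′),(x̄σ)}`, `h = hubbardOneBody (fermionTorusGraph 2 L) 1 μ` — the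
time-ordered free propagator at time difference `−s` (`−n_F e^{ξ s}` branch, with the entry's overall minus sign) against the creation-before-
annihilation Fermi-matrix entry with creation time `s` and annihilation time `0`. -/
theorem vertexLimitEntry_neg_eq_fermiMatrix_entry (hL : 3 ≤ L) (β μ : ℝ) (σ σ' : Fin 2) (xe ye : TorusSite 2 L) {s : ℝ} (hs : 0 < s) :
    vertexLimitEntry L β μ xe ye σ σ' (0 - s) =
      (exp (-((0 : ℂ) • hubbardOneBody (fermionTorusGraph 2 L) 1 μ)) *
          (1 + exp ((β : ℂ) • hubbardOneBody (fermionTorusGraph 2 L) 1 μ))⁻¹ *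
          exp ((s : ℂ) • hubbardOneBody (fermionTorusGraph 2 L) 1 μ))
        (orb (FermionTorus.ofTorusSite ye) σ') (orb (FermionTorus.ofTorusSite xe) σ) := by
  -- the right-hand side is the `a ≤ b` entry of a two-pair propagator matrix: pair 0 = (x̄σ) at time `s`, pair 1 = (ȳσ′) at time `0`
  have hprop := propMatrix_torus_orb_apply₂ hL β μ (N := 2)
    (![FermionTorus.ofTorusSite xe, FermionTorus.ofTorusSite ye]) (![FermionTorus.ofTorusSite xe, FermionTorus.ofTorusSite ye])
    (![σ, σ']) (![σ, σ']) (![(s : ℂ), 0]) 0 1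
  simp only [propMatrix, Matrix.of_apply, Fin.zero_le, if_true, Matrix.cons_val_zero, Matrix.cons_val_one,
    FermionTorus.toTorusSite_ofTorusSite] at hprop
  rw [hprop, vertexLimitEntry_eq_torusChar]
  have hL2 : ((1 / (L : ℝ) ^ 2 : ℝ) : ℂ) = ((L : ℂ) ^ 2)⁻¹ := by push_cast; rw [one_div]
  by_cases hσ : σ = σ'
  · subst hσ
    rw [if_pos rfl, if_pos rfl, hL2, show xe - ye = -(ye - xe) by abel,
      sum_torusChar_neg_of_even _ _ (fun q => by simp only [nambuXi, torusBand_neg]), ← mul_neg, ← Finset.sum_neg_distrib]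
    refine congrArg _ (sum_congr rfl fun q _ => ?_)
    rw [← mul_neg]
    refine congrArg _ ?_
    -- scalar match: `−G_β(ξ, −s) = e^{sξ} f_β(ξ)` for `s > 0`
    have hneg : (0 : ℝ) - s < 0 := by linarith
    rw [timeOrderedPropagator_of_neg β (nambuXi L μ q) hneg, nambuXi, fermiFunction]
    push_cast
    rw [neg_neg, one_div, mul_comm]
    congr 2
    ring
  · rw [if_neg hσ, if_neg (Ne.symm hσ), neg_zero]

end Summit.HubbardSuperconductivity.HubbardSuperconductivity.Theorems.TwoPointAssembly

end
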